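import Summits.BirchSwinnertonDyer.BirchSwinnertonDyer.Theorems.SignedLowerHalvesSmallImageLowerHalfBothSignsRttCharRoadE2QuasiIso
import Summits.BirchSwinnertonDyer.Rank1Residual.X2.DualRestrictionInvariants
import Literature.NumberTheory.EllipticCurves.IwasawaSelmerIsTorsionProofs
import HarnessLib

/-!
# Route `SignedLowerHalves`, crux L `SmallImageLowerHalfBothSigns` (stmt-BirchSwinnertonDyer-23599), line `rtt_w3` v13 — E2, rows J2/J4 of the junction, LEAD:
# `λ` IS MONOTONE along injections and along maps with finite kernel (plain `Λ`-currency sockets for `hcoker` and `hY`)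

WHY (HELPER-TABLE v13 addendum 7, rows J2 and J4; LEAD g10). The two numerical inputs of `SmallImageRttCharRoad.charRoad_E2_of_roadD_junction` are
`hcoker : λ(B ⧸ range sp¹) ≤ λ(H²₂[f])` and `hY : λ(H²₂/f) ≤ λ(coker gX)`; the Galois side delivers them as MAPS — `coker sp¹ ↪ H²₂[f]` (derived
specialisation sequence) and `H²₂/f ≅ 𝐇²_Σ(K^cyc_∞, T*) → Ш²_Σ ≅ coker gX` with FINITE kernel (the local `𝐇²(K^cyc_{∞,w}, T*)`, `w ∈ Σ`). This file turns such
maps into the inequalities, over `Λ = ℤ_p⟦T⟧` and with no `𝒪`-structure bookkeeping: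
* `lambdaInvariant_le_of_injective_of_isTorsion` — `M ↪ N` `Λ`-linear, `N` f.g. torsion ⟹ `λ M ≤ λ N`;
* `lambdaInvariant_le_of_finite_ker_of_isTorsion` — `M → N` `Λ`-linear with FINITE kernel, `N` f.g. torsion ⟹ `λ M ≤ λ N`;
* `…_restrictScalars` forms for `Λ_𝒪`-linear maps between `Λ_𝒪`-modules with scalar-tower `Λ`-structures.
THEOREMS ONLY (kernel commutative algebra; `--supports stmt-BirchSwinnertonDyer-23599` helper); closes nothing; crux L, crux M, E2 and BSD remain OPEN and are
proved for NO curve by any of this. [cite: Washington1997, §13.2] [folklore]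
-/

set_option linter.dupNamespace false -- D-0017: single-problem summit, the namespace repeats the problem name by design
set_option autoImplicit false

noncomputable section

namespace Summit.BirchSwinnertonDyer.BirchSwinnertonDyer.Theorems.SmallImageRttCharRoad

open Literature.NumberTheory.EllipticCurves

universe u v

variable {p : ℕ} [Fact p.Prime]

section Lambda

variable {M : Type u} {N : Type v} [AddCommGroup M] [Module (IwasawaAlgebra p) M] [AddCommGroup N] [Module (IwasawaAlgebra p) N]

/-- **`λ` increases along injections**: `f : M → N` `Λ`-linear injective, `N` finitely generated torsion ⟹ `lambdaInvariant p M ≤ lambdaInvariant p N`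
(`λ N = λ(range f) + λ(N ⧸ range f)` and `M ≅ range f`). [cite: Washington1997, §13.2] [folklore] -/
theorem lambdaInvariant_le_of_injective_of_isTorsion (f : M →ₗ[IwasawaAlgebra p] N) (hf : Function.Injective f)
    [Module.Finite (IwasawaAlgebra p) N] (hN : Module.IsTorsion (IwasawaAlgebra p) N) :
    lambdaInvariant p M ≤ lambdaInvariant p N := by
  have h := Summit.BirchSwinnertonDyer.Rank1Residual.X2.DualRestrictionInvariants.lambdaInvariant_eq_add_of_surjective p
    (LinearMap.range f).mkQ hN (Submodule.mkQ_surjective _)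
  have hk : lambdaInvariant p (LinearMap.ker (LinearMap.range f).mkQ) = lambdaInvariant p M :=
    lambdaInvariant_eq_of_linearEquiv ((LinearEquiv.ofEq _ _ (Submodule.ker_mkQ _)).trans (LinearEquiv.ofInjective f hf).symm)
  omega

/-- **`λ` increases along maps with finite kernel**: `f : M → N` `Λ`-linear with FINITE kernel, `N` finitely generated torsion ⟹
`lambdaInvariant p M ≤ lambdaInvariant p N` (`M → range f` is a quasi-isomorphism, p776013, and `range f ↪ N`). [cite: Washington1997, §13.2] [folklore] -/
theorem lambdaInvariant_le_of_finite_ker_of_isTorsion (f : M →ₗ[IwasawaAlgebra p] N) (hker : Finite (LinearMap.ker f))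
    [Module.Finite (IwasawaAlgebra p) N] (hN : Module.IsTorsion (IwasawaAlgebra p) N) :
    lambdaInvariant p M ≤ lambdaInvariant p N := by
  -- `M → range f`: finite kernel, zero cokernel
  have hq : lambdaInvariant p M = lambdaInvariant p (LinearMap.range f) := by
    refine lambdaInvariant_eq_of_finite_ker_coker f.rangeRestrict ?_ ?_
    · rw [LinearMap.ker_rangeRestrict]; exact hker
    · rw [LinearMap.range_rangeRestrict]; infer_instance
  rw [hq]
  exact lambdaInvariant_le_of_injective_of_isTorsion (LinearMap.range f).subtype (Submodule.subtype_injective _) hN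

end Lambda

section LambdaO

variable {S : Set (PadicAlgCl p)} [Algebra (IwasawaAlgebra p) (IwasawaAlgebraO S)]
  {M : Type u} {N : Type v} [AddCommGroup M] [Module (IwasawaAlgebraO S) M] [Module (IwasawaAlgebra p) M]
  [IsScalarTower (IwasawaAlgebra p) (IwasawaAlgebraO S) M]
  [AddCommGroup N] [Module (IwasawaAlgebraO S) N] [Module (IwasawaAlgebra p) N] [IsScalarTower (IwasawaAlgebra p) (IwasawaAlgebraO S) N]

/-- `Λ_𝒪`-linear injections between `Λ_𝒪`-modules with scalar-tower `Λ`-structures: `λ M ≤ λ N` for `N` f.g. torsion over `Λ` (row J2: `coker sp¹ ↪ H²₂[f]`).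
[cite: Washington1997, §13.2] [folklore] -/
theorem lambdaInvariant_le_of_injective_of_isTorsion_restrictScalars (f : M →ₗ[IwasawaAlgebraO S] N) (hf : Function.Injective f)
    [Module.Finite (IwasawaAlgebra p) N] (hN : Module.IsTorsion (IwasawaAlgebra p) N) :
    lambdaInvariant p M ≤ lambdaInvariant p N :=
  lambdaInvariant_le_of_injective_of_isTorsion (f.restrictScalars (IwasawaAlgebra p)) hf hN

/-- `Λ_𝒪`-linear maps with FINITE kernel between `Λ_𝒪`-modules with scalar-tower `Λ`-structures: `λ M ≤ λ N` for `N` f.g. torsion over `Λ`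
(row J4: `H²₂/f ≅ 𝐇²_Σ → coker gX`, kernel from the finite local `𝐇²`). [cite: Washington1997, §13.2] [folklore] -/
theorem lambdaInvariant_le_of_finite_ker_of_isTorsion_restrictScalars (f : M →ₗ[IwasawaAlgebraO S] N) (hker : Finite (LinearMap.ker f))
    [Module.Finite (IwasawaAlgebra p) N] (hN : Module.IsTorsion (IwasawaAlgebra p) N) :
    lambdaInvariant p M ≤ lambdaInvariant p N := by
  refine lambdaInvariant_le_of_finite_ker_of_isTorsion (f.restrictScalars (IwasawaAlgebra p)) ?_ hN
  rw [LinearMap.ker_restrictScalars]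
  exact hker

end LambdaO

end Summit.BirchSwinnertonDyer.BirchSwinnertonDyer.Theorems.SmallImageRttCharRoad

end
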